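import Summits.RiemannHypothesis.RiemannHypothesis.Theses.WeilParity
import Summits.RiemannHypothesis.RiemannHypothesis.Theorems.WeilParityEvenWinsBeyondArchSplit
import Summits.RiemannHypothesis.RiemannHypothesis.Theorems.WeilWindowFlowGronwallLeakageStrictAnti
import Literature.NumberTheory.LFunctions.WeilFirstPrimePositivityC
import HarnessLib

/-!
# Crux `EvenWinsBeyondArch` (stmt-RiemannHypothesis-15432) — load-bearing hypotheses (refuter, negative lane)

Route `WeilParity`, crux #3:
`EvenWinsBeyondArch := ∀ a > (log 2)/2, ∀ o` odd `L²`-normalised Weil test on `[-a, a]`, `∀ δ > 0`,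
`∃ e` even `L²`-normalised Weil test on `[-a, a]` with `Re Q(e) ≤ Re Q(o) + δ`
(`Q = weilQuadratic`; equivalently `ε_ev(a) ≤ ε_od(a)` for every `a > (log 2)/2`).

Findings of the crux attack (kernel-checked here; none of them refutes the crux):

* `evenWinsBeyondArch_false_without_oddNorm` — dropping the normalisation `∫ ‖o‖² = 1` of the odd
  competitor makes the statement FALSE: `o = 0` on the window `a = 2/5` would force `ε_ev(2/5) ≤ 0`,
  while `ε_ev(2/5) ≥ ε(2/5) > 0` RH-free (certified first-prime positivity at `(log 3)/2`,
  `weilPositivityOn_log_three_half`, plus strict antitonicity of `ε`,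
  `weilGroundEnergy_pos_of_weilPositivityOn_of_lt`). Any proof must use `∫ ‖o‖² = 1`.
* `evenWinsBeyondArch_trivial_without_evenness` — dropping the evenness of the matching test `e` makes the
  statement TRIVIAL (`e := o`): the parity constraint on `e` carries all the content.
* `evenWinsBeyondArch_iff_without_oddness` — the ODDNESS of `o` is NOT load-bearing: the crux is
  equivalent to the same statement with `o` ranging over ALL normalised window tests, i.e. to
  "the even sector realises the global bottom", `ε_ev(a) = ε(a)` for every `a > (log 2)/2`
  (`evenWinsBeyondArch_iff_weilEvenGroundEnergy_eq`, from the landed `evenWinsBeyondArch_iff_forall_le`), by the parity split `ε = min (ε_ev, ε_od)`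
  (`weilGroundEnergy_eq_min_even_odd`, Suzuki 2026 (4.10)).
* `evenWinsBeyondArch_without_evenNorm_of_riemannHypothesis` — dropping the normalisation of `e` makes the
  statement a consequence of RH with the junk witness `e = 0` (odd-sector positivity, Yoshida's proved
  half): the normalisation of `e` is what keeps the crux from being RH-trivial.
* `exists_strictOrder_near_threshold` / `evenWinsBeyondArch_near_threshold` — boundary: the strict order
  `ε_ev < ε_od`, hence the crux, HOLDS on a right-neighbourhood `[(log 2)/2, (log 2)/2 + η)` of the
  threshold (certified anchor + landed sector continuity), so a refuting window is bounded away from it.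
-/

noncomputable section

open Set MeasureTheory Filter
open scoped Real Topology

set_option linter.dupNamespace false

namespace Summit.RiemannHypothesis.RiemannHypothesis.Theorems.EvenWinsBeyondArch.Negative

open Literature.NumberTheory.LFunctions
open Summit.RiemannHypothesis.RiemannHypothesis.Theses.WeilParity
open Summit.RiemannHypothesis.RiemannHypothesis.Theorems.WeilWindowFlowGronwallLeakage
  (weilGroundEnergy_pos_of_weilPositivityOn_of_lt)

/-! ## Numerical facts about the witness window `a = 2/5` -/

/-- `(log 2)/2 < 2/5`. [folklore] -/
theorem log_two_half_lt_two_fifths : Real.log 2 / 2 < 2 / 5 := by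
  have := Real.log_two_lt_d9
  linarith

/-- `2/5 < (log 3)/2` (indeed `1 < log 3` as `e < 3`). [folklore] -/
theorem two_fifths_lt_log_three_half : (2 / 5 : ℝ) < Real.log 3 / 2 := by
  have h1 : (1 : ℝ) < Real.log 3 := by
    rw [Real.lt_log_iff_exp_lt (by norm_num)]
    have := Real.exp_one_lt_d9
    linarith
  linarith

/-- **`ε_ev(2/5) > 0`, RH-free**: certified first-prime Weil positivity on the window `(log 3)/2`
gives `ε((log 3)/2) ≥ 0`, strict antitonicity of `ε` gives `ε(2/5) > 0`, and `ε ≤ ε_ev`. [folklore] -/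
theorem weilEvenGroundEnergy_two_fifths_pos : 0 < weilEvenGroundEnergy (2 / 5) :=
  lt_of_lt_of_le
    (weilGroundEnergy_pos_of_weilPositivityOn_of_lt weilPositivityOn_log_three_half (by norm_num)
      two_fifths_lt_log_three_half)
    (weilGroundEnergy_le_weilEvenGroundEnergy _)

/-- The zero function is supported in every window. [folklore] -/
theorem tsupport_zero_subset (s : Set ℝ) : tsupport (0 : ℝ → ℂ) ⊆ s := by
  rw [tsupport_eq_empty_iff.2 rfl]
  exact empty_subset _

/-! ## (a) The normalisation of the odd competitor is load-bearing -/

/-- **Any proof of the crux must use `∫ ‖o‖² = 1`** (the crux with that hypothesis deleted is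
FALSE): without it, `o = 0` (odd, supported in every window, `Q(0) = 0`) at `a = 2/5` with
`δ = ε_ev(2/5)/2` would give a normalised even `e` with `Re Q(e) ≤ ε_ev(2/5)/2 < ε_ev(2/5) ≤ Re Q(e)`.
[folklore] -/
theorem evenWinsBeyondArch_false_without_oddNorm :
    ¬ ∀ a : ℝ, Real.log 2 / 2 < a → ∀ o : ℝ → ℂ, IsWeilTest o → tsupport o ⊆ Set.Icc (-a) a →
        (∀ t, o (-t) = -o t) → ∀ δ : ℝ, 0 < δ → ∃ e : ℝ → ℂ, IsWeilTest e ∧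
          tsupport e ⊆ Set.Icc (-a) a ∧ (∀ t, e (-t) = e t) ∧ ∫ t, ‖e t‖ ^ 2 = (1 : ℝ) ∧
            (weilQuadratic e).re ≤ (weilQuadratic o).re + δ := by
  intro h
  have hpos := weilEvenGroundEnergy_two_fifths_pos
  obtain ⟨e, he, hes, hev, hen, hle⟩ := h (2 / 5) log_two_half_lt_two_fifths 0
    ⟨contDiff_const, HasCompactSupport.zero⟩ (tsupport_zero_subset _) (fun t ↦ by simp) (weilEvenGroundEnergy (2 / 5) / 2) (by positivity)
  have hE := weilEvenGroundEnergy_le he hes hev hen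
  rw [weilQuadratic_zero, Complex.zero_re, zero_add] at hle
  linarith

/-! ## (b) The evenness of the matching test carries all the content -/

/-- **Without the parity constraint on `e` the statement is trivial** (`e := o`): the crux with the
evenness of the matching test deleted holds outright. [folklore] -/
theorem evenWinsBeyondArch_trivial_without_evenness :
    ∀ a : ℝ, Real.log 2 / 2 < a → ∀ o : ℝ → ℂ, IsWeilTest o → tsupport o ⊆ Set.Icc (-a) a →
      (∀ t, o (-t) = -o t) → ∫ t, ‖o t‖ ^ 2 = (1 : ℝ) → ∀ δ : ℝ, 0 < δ → ∃ e : ℝ → ℂ, IsWeilTest e ∧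
        tsupport e ⊆ Set.Icc (-a) a ∧ ∫ t, ‖e t‖ ^ 2 = (1 : ℝ) ∧
          (weilQuadratic e).re ≤ (weilQuadratic o).re + δ :=
  fun _ _ o ho hos _ hon δ hδ ↦ ⟨o, ho, hos, hon, by linarith⟩

/-! ## (c) The oddness of the competitor is NOT load-bearing: the crux says `ε_ev = ε` -/

/-- **The crux in the form "the even sector realises the global bottom"**:
`EvenWinsBeyondArch ↔ ∀ a > (log 2)/2, ε_ev(a) = ε(a)` (parity split `ε = min (ε_ev, ε_od)`).
[folklore] -/
theorem evenWinsBeyondArch_iff_weilEvenGroundEnergy_eq :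
    EvenWinsBeyondArch ↔ ∀ a : ℝ, Real.log 2 / 2 < a → weilEvenGroundEnergy a = weilGroundEnergy a := by
  constructor
  · intro h a ha
    rw [weilGroundEnergy_eq_min_even_odd,
      min_eq_left ((evenWinsBeyondArch_iff_forall_le.1 h) a ha)]
  · intro h a ha o ho hos hodd hon δ hδ
    have ha0 : 0 < a := log_two_half_pos.trans ha
    have hle : weilEvenGroundEnergy a ≤ (weilQuadratic o).re := by
      rw [h a ha]
      exact (weilGroundEnergy_le_weilOddGroundEnergy a).trans (weilOddGroundEnergy_le ho hos hodd hon)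
    have hlt : sInf (weilWindowSphereValues (fun g ↦ ∀ t, g (-t) = g t) a) <
        (weilQuadratic o).re + δ := by
      rw [← weilEvenGroundEnergy_eq_sInf]
      linarith
    obtain ⟨x, hxS, hx⟩ := exists_lt_of_csInf_lt (weilWindowSphereValues_even_nonempty ha0) hlt
    obtain ⟨e, he, hes, hev, hen, rfl⟩ := hxS
    exact ⟨e, he, hes, hev, hen, hx.le⟩

/-- **The oddness of `o` can be dropped**: the crux is equivalent to matching EVERY normalised window
test by an even one (both say `ε_ev(a) = ε(a)` for `a > (log 2)/2`). Information for provers: no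
structure of odd functions is available to exploit on the hypothesis side. [folklore] -/
theorem evenWinsBeyondArch_iff_without_oddness :
    EvenWinsBeyondArch ↔
      ∀ a : ℝ, Real.log 2 / 2 < a → ∀ o : ℝ → ℂ, IsWeilTest o → tsupport o ⊆ Set.Icc (-a) a →
        ∫ t, ‖o t‖ ^ 2 = (1 : ℝ) → ∀ δ : ℝ, 0 < δ → ∃ e : ℝ → ℂ, IsWeilTest e ∧
          tsupport e ⊆ Set.Icc (-a) a ∧ (∀ t, e (-t) = e t) ∧ ∫ t, ‖e t‖ ^ 2 = (1 : ℝ) ∧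
            (weilQuadratic e).re ≤ (weilQuadratic o).re + δ := by
  refine ⟨fun h a ha o ho hos hon δ hδ ↦ ?_, fun h a ha o ho hos _ hon δ hδ ↦ h a ha o ho hos hon δ hδ⟩
  have ha0 : 0 < a := log_two_half_pos.trans ha
  have hE : weilEvenGroundEnergy a = weilGroundEnergy a :=
    (evenWinsBeyondArch_iff_weilEvenGroundEnergy_eq.1 h) a ha
  have hle : weilEvenGroundEnergy a ≤ (weilQuadratic o).re := by
    rw [hE, weilGroundEnergy_eq_sInf]
    exact csInf_le (bddBelow_weilWindowSphereValues _ a) ⟨o, ho, hos, trivial, hon, rfl⟩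
  have hlt : sInf (weilWindowSphereValues (fun g ↦ ∀ t, g (-t) = g t) a) <
      (weilQuadratic o).re + δ := by
    rw [← weilEvenGroundEnergy_eq_sInf]
    linarith
  obtain ⟨x, hxS, hx⟩ := exists_lt_of_csInf_lt (weilWindowSphereValues_even_nonempty ha0) hlt
  obtain ⟨e, he, hes, hev, hen, rfl⟩ := hxS
  exact ⟨e, he, hes, hev, hen, hx.le⟩

/-! ## (d) The normalisation of the matching test keeps the crux from being RH-trivial -/

/-- **Without `∫ ‖e‖² = 1` the statement follows from RH with the junk witness `e = 0`**: under RH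
the odd sector is nonnegative (`weilOddGroundEnergy_nonneg_of_riemannHypothesis`, Yoshida's proved
half), so `Re Q(0) = 0 ≤ ε_od(a) ≤ Re Q(o) < Re Q(o) + δ`. [folklore] -/
theorem evenWinsBeyondArch_without_evenNorm_of_riemannHypothesis (hRH : RiemannHypothesis) :
    ∀ a : ℝ, Real.log 2 / 2 < a → ∀ o : ℝ → ℂ, IsWeilTest o → tsupport o ⊆ Set.Icc (-a) a →
      (∀ t, o (-t) = -o t) → ∫ t, ‖o t‖ ^ 2 = (1 : ℝ) → ∀ δ : ℝ, 0 < δ → ∃ e : ℝ → ℂ, IsWeilTest e ∧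
        tsupport e ⊆ Set.Icc (-a) a ∧ (∀ t, e (-t) = e t) ∧
          (weilQuadratic e).re ≤ (weilQuadratic o).re + δ := by
  intro a _ o ho hos hodd hon δ hδ
  refine ⟨0, ⟨contDiff_const, HasCompactSupport.zero⟩, tsupport_zero_subset _, fun t ↦ by simp, ?_⟩
  rw [weilQuadratic_zero, Complex.zero_re]
  have h0 := weilOddGroundEnergy_nonneg_of_riemannHypothesis hRH a
  have h1 := weilOddGroundEnergy_le ho hos hodd hon
  linarith

/-- The same mutation holds UNCONDITIONALLY on the certified range `(log 2)/2 < a ≤ (log 3)/2`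
(first-prime Weil positivity, `weilPositivityOn_log_three_half`). [folklore] -/
theorem evenWinsBeyondArch_without_evenNorm_on_firstPrimeWindow :
    ∀ a : ℝ, Real.log 2 / 2 < a → a ≤ Real.log 3 / 2 → ∀ o : ℝ → ℂ, IsWeilTest o →
      tsupport o ⊆ Set.Icc (-a) a → (∀ t, o (-t) = -o t) → ∫ t, ‖o t‖ ^ 2 = (1 : ℝ) → ∀ δ : ℝ, 0 < δ →
        ∃ e : ℝ → ℂ, IsWeilTest e ∧ tsupport e ⊆ Set.Icc (-a) a ∧ (∀ t, e (-t) = e t) ∧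
          (weilQuadratic e).re ≤ (weilQuadratic o).re + δ := by
  intro a _ ha3 o ho hos _ _ δ hδ
  refine ⟨0, ⟨contDiff_const, HasCompactSupport.zero⟩, tsupport_zero_subset _, fun t ↦ by simp, ?_⟩
  rw [weilQuadratic_zero, Complex.zero_re]
  have h0 : 0 ≤ (weilQuadratic o).re := weilPositivityOn_log_three_half o ho
    (hos.trans (Icc_subset_Icc (neg_le_neg ha3) ha3))
  linarith

/-! ## (e) Boundary: a counterexample window cannot sit at the threshold -/

/-- **The crux cannot first fail at the threshold `(log 2)/2`**: there is `η > 0` such that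
`ε_ev(a) < ε_od(a)` for every `a ∈ [(log 2)/2, (log 2)/2 + η)` — the certified anchor
`ε_ev((log 2)/2) < ε_od((log 2)/2)` (`weilEvenGroundEnergy_lt_weilOddGroundEnergy_log_two_half`) and the
landed RH-free continuity of both sector bottoms (`stub_sectorContinuity`). Hence a refuting window, if
any, lies at some `a ≥ (log 2)/2 + η`; numerically (sister crux `GroundStateSimpleEven`, Disproof table)
none exists on `a ≤ 1.2`. [folklore] -/
theorem exists_strictOrder_near_threshold :
    ∃ η : ℝ, 0 < η ∧ ∀ a : ℝ, Real.log 2 / 2 ≤ a → a < Real.log 2 / 2 + η →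
      weilEvenGroundEnergy a < weilOddGroundEnergy a := by
  have ha₀ : 0 < Real.log 2 / 2 := log_two_half_pos
  have hmem : Set.Ioi (0 : ℝ) ∈ 𝓝 (Real.log 2 / 2) := Ioi_mem_nhds ha₀
  have hce : ContinuousAt weilEvenGroundEnergy (Real.log 2 / 2) :=
    stub_sectorContinuity.1.continuousAt hmem
  have hco : ContinuousAt weilOddGroundEnergy (Real.log 2 / 2) :=
    stub_sectorContinuity.2.continuousAt hmem
  have hev := hce.eventually_lt hco weilEvenGroundEnergy_lt_weilOddGroundEnergy_log_two_half
  obtain ⟨η, hη, hball⟩ := Metric.eventually_nhds_iff.1 hev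
  refine ⟨η, hη, fun a ha1 ha2 ↦ hball ?_⟩
  rw [Real.dist_eq, abs_of_nonneg (by linarith)]
  linarith

/-- The junk-free crux itself therefore HOLDS on a right-neighbourhood of the threshold (evidence for
provers; not a route item). [folklore] -/
theorem evenWinsBeyondArch_near_threshold :
    ∃ η : ℝ, 0 < η ∧ ∀ a : ℝ, Real.log 2 / 2 < a → a < Real.log 2 / 2 + η → ∀ o : ℝ → ℂ,
      IsWeilTest o → tsupport o ⊆ Set.Icc (-a) a → (∀ t, o (-t) = -o t) → ∫ t, ‖o t‖ ^ 2 = (1 : ℝ) →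
        ∀ δ : ℝ, 0 < δ → ∃ e : ℝ → ℂ, IsWeilTest e ∧ tsupport e ⊆ Set.Icc (-a) a ∧
          (∀ t, e (-t) = e t) ∧ ∫ t, ‖e t‖ ^ 2 = (1 : ℝ) ∧
            (weilQuadratic e).re ≤ (weilQuadratic o).re + δ := by
  obtain ⟨η, hη, hlt⟩ := exists_strictOrder_near_threshold
  refine ⟨η, hη, fun a ha1 ha2 o ho hos hodd hon δ hδ ↦ ?_⟩
  have ha0 : 0 < a := log_two_half_pos.trans ha1
  have hle : weilEvenGroundEnergy a ≤ (weilQuadratic o).re :=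
    (hlt a ha1.le ha2).le.trans (weilOddGroundEnergy_le ho hos hodd hon)
  have hlt' : sInf (weilWindowSphereValues (fun g ↦ ∀ t, g (-t) = g t) a) <
      (weilQuadratic o).re + δ := by
    rw [← weilEvenGroundEnergy_eq_sInf]
    linarith
  obtain ⟨x, hxS, hx⟩ := exists_lt_of_csInf_lt (weilWindowSphereValues_even_nonempty ha0) hlt'
  obtain ⟨e, he, hes, hev, hen, rfl⟩ := hxS
  exact ⟨e, he, hes, hev, hen, hx.le⟩

end Summit.RiemannHypothesis.RiemannHypothesis.Theorems.EvenWinsBeyondArch.Negative
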